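import Literature.Probability.Percolation.ZonesOwners
import HarnessLib

/-!
# Half-open blocks of the plane and their lattice sites

Topic `Probability/Percolation`.  Support file (definitions and proofs, no named fact) for the zone
geometry of the proof of Schramm–Smirnov's Prop. 4.1 (Ann. Probab. 39 (2011), §4: the strip `K`,
the neighbourhood of the cut and the far region are digitised at each mesh).  The plane is tiled by
the HALF-OPEN squares `[t a, t (a+1)) × [t b, t (b+1))` of side `t` (a fixed real scale, independent of
the mesh `δ`), and a lattice site `v` of `δℤ²` is assigned the unique block `bOf t δ v` containing its
mesh point.  Elementary facts, for `0 < δ`, `2δ ≤ t`: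

* `near_bOf_of_adj` — lattice neighbours lie in sup-adjacent blocks;
* `exists_nbr_same_bOf` — every site has a lattice neighbour in its own block (blocks are at least
  two sites wide);
* `bOfSites_connected` — the sites of one block are joined through sites of the block;
* `exists_adj_sites_of_oneStep` — 4-adjacent blocks contain adjacent sites;
* `finite_sites_of_bOf` — finitely many sites have their block in a finite set.

## References

* O. Schramm, S. Smirnov, Ann. Probab. 39 (2011), arXiv:1101.5820, §4, proof of Prop. 4.1 (setup
  for the neighbourhood of `α`). [SchrammSmirnov2011]
-/

noncomputable section

open Set Relation
open Literature.Probability.LatticeModels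

namespace Literature.Probability.Percolation

namespace FineBlocks

open CellComplex

variable (t δ : ℝ)

/-- **The block of a site**: the half-open `t`-square containing its mesh point at mesh `δ`
(lower-left convention). [folklore] -/
def bOf (v : Site 2) : ℤ × ℤ := (⌊δ * v 0 / t⌋, ⌊δ * v 1 / t⌋)

/-- **Sup-adjacency of blocks** (distance `≤ 1` in both coordinates, a block is near itself). [folklore] -/
def Near (a b : ℤ × ℤ) : Prop := |a.1 - b.1| ≤ 1 ∧ |a.2 - b.2| ≤ 1

/-- **4-adjacency of blocks.** [folklore] -/
def OneStep (a b : ℤ × ℤ) : Prop := (a.1 = b.1 ∧ |a.2 - b.2| = 1) ∨ (a.2 = b.2 ∧ |a.1 - b.1| = 1)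

variable {t δ}

/-- `Near` is reflexive. [folklore] -/
theorem near_refl (a : ℤ × ℤ) : Near a a := by simp [Near]

/-- `Near` is symmetric. [folklore] -/
theorem Near.symm {a b : ℤ × ℤ} (h : Near a b) : Near b a := by
  obtain ⟨h1, h2⟩ := h
  exact ⟨by rw [abs_sub_comm]; exact h1, by rw [abs_sub_comm]; exact h2⟩

/-- A 4-step is a sup-adjacency. [folklore] -/
theorem OneStep.near {a b : ℤ × ℤ} (h : OneStep a b) : Near a b := by
  rcases h with ⟨h1, h2⟩ | ⟨h1, h2⟩
  · exact ⟨by rw [h1]; simp, h2.le⟩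
  · exact ⟨h2.le, by rw [h1]; simp⟩

/-- `OneStep` is symmetric. [folklore] -/
theorem OneStep.symm {a b : ℤ × ℤ} (h : OneStep a b) : OneStep b a := by
  rcases h with ⟨h1, h2⟩ | ⟨h1, h2⟩
  · exact Or.inl ⟨h1.symm, by rw [abs_sub_comm]; exact h2⟩
  · exact Or.inr ⟨h1.symm, by rw [abs_sub_comm]; exact h2⟩

/-! ### Floors along a lattice step -/

/-- Moving by `δ ≤ t` changes the floor by at most one (upwards). [folklore] -/
theorem floor_step_le (ht : 0 < t) (hδ : 0 ≤ δ) (hδt : δ ≤ t) (x : ℝ) :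
    ⌊x / t⌋ ≤ ⌊(x + δ) / t⌋ ∧ ⌊(x + δ) / t⌋ ≤ ⌊x / t⌋ + 1 := by
  constructor
  · exact Int.floor_le_floor (div_le_div_of_nonneg_right (by linarith) ht.le)
  · have : (x + δ) / t ≤ x / t + 1 := by
      rw [div_add_one ht.ne', div_le_div_iff_of_pos_right ht]; linarith
    calc ⌊(x + δ) / t⌋ ≤ ⌊x / t + 1⌋ := Int.floor_le_floor this
      _ = ⌊x / t⌋ + 1 := Int.floor_add_one _

/-- The coordinates of a lattice neighbour. [folklore] -/
theorem coord_add_cornerUnit (v : Site 2) (k : Fin 4) (i : Fin 2) :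
    (v + cornerUnit k) i = v i + cornerUnit k i := rfl

/-- **Lattice neighbours lie in sup-adjacent blocks.** [folklore] -/
theorem near_bOf_of_adj (ht : 0 < t) (hδ : 0 < δ) (hδt : δ ≤ t) {u v : Site 2} (h : (zdGraph 2).Adj u v) :
    Near (bOf t δ u) (bOf t δ v) := by
  obtain ⟨k, rfl⟩ := adj_iff_exists_cornerUnit.1 h
  -- one coordinate moves by `±1`, the other is fixed
  have key : ∀ (x : ℤ) (e : ℤ), |e| ≤ 1 → |⌊δ * x / t⌋ - ⌊δ * (x + e : ℤ) / t⌋| ≤ 1 := by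
    intro x e he
    rw [abs_le] at he
    rcases (by omega : e = -1 ∨ e = 0 ∨ e = 1) with rfl | rfl | rfl
    · have h := floor_step_le ht hδ.le hδt (δ * ((x - 1 : ℤ) : ℝ))
      have e1 : δ * ((x - 1 : ℤ) : ℝ) + δ = δ * x := by push_cast; ring
      rw [e1] at h
      rw [show x + -1 = x - 1 by ring, abs_le]; omega
    · simp
    · have h := floor_step_le ht hδ.le hδt (δ * x)
      have e1 : δ * (x : ℝ) + δ = δ * ((x + 1 : ℤ) : ℝ) := by push_cast; ring
      rw [e1] at h
      rw [abs_le]; omega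
  have hk : ∀ i : Fin 2, |cornerUnit k i| ≤ 1 := by
    intro i; fin_cases k <;> fin_cases i <;> simp [cornerUnit]
  refine ⟨?_, ?_⟩
  · simp only [bOf, coord_add_cornerUnit]
    exact key (u 0) (cornerUnit k 0) (hk 0)
  · simp only [bOf, coord_add_cornerUnit]
    exact key (u 1) (cornerUnit k 1) (hk 1)

/-- **Every site has a neighbour in its own block in the first coordinate direction** (blocks are two
sites wide: `2δ ≤ t`). [folklore] -/
theorem exists_nbr_same_bOf (ht : 0 < t) (hδ : 0 < δ) (hδt : 2 * δ ≤ t) (v : Site 2) :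
    ∃ k : Fin 4, bOf t δ (v + cornerUnit k) = bOf t δ v := by
  -- either `v + e₀` or `v - e₀` stays in the block
  set x : ℝ := δ * v 0 with hx
  by_cases h : ⌊(x + δ) / t⌋ = ⌊x / t⌋
  · refine ⟨0, ?_⟩
    simp only [bOf, coord_add_cornerUnit, Prod.mk.injEq]
    refine ⟨?_, by simp [cornerUnit]⟩
    have : δ * ((v 0 + cornerUnit 0 0 : ℤ) : ℝ) = x + δ := by simp [cornerUnit, hx]; ring
    rw [this, h]
  · refine ⟨2, ?_⟩
    simp only [bOf, coord_add_cornerUnit, Prod.mk.injEq]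
    refine ⟨?_, by simp [cornerUnit]⟩
    have e2 : δ * ((v 0 + cornerUnit 2 0 : ℤ) : ℝ) = x - δ := by simp [cornerUnit, hx]; ring
    rw [e2]
    -- `⌊(x+δ)/t⌋ = ⌊x/t⌋ + 1` forces `x ≥ t ⌊x/t⌋ + t - δ ≥ t ⌊x/t⌋ + δ`
    obtain ⟨h1, h2⟩ := floor_step_le ht hδ.le (by linarith) x
    have hup : ⌊(x + δ) / t⌋ = ⌊x / t⌋ + 1 := by omega
    set n := ⌊x / t⌋ with hn
    have hx1 : ((n + 1 : ℤ) : ℝ) ≤ (x + δ) / t := by rw [← hup]; exact Int.floor_le _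
    have hx1' : t * (n + 1) ≤ x + δ := by
      rw [le_div_iff₀ ht] at hx1; push_cast at hx1; linarith
    have hlow : (n : ℝ) ≤ (x - δ) / t := by
      rw [le_div_iff₀ ht]; nlinarith
    have hhigh : (x - δ) / t < n + 1 := by
      have : x / t < n + 1 := by rw [hn]; exact Int.lt_floor_add_one _
      have h' : (x - δ) / t ≤ x / t := div_le_div_of_nonneg_right (by linarith) ht.le
      linarith
    exact Int.floor_eq_iff.2 ⟨hlow, hhigh⟩

/-! ### Sites of a block -/

/-- The sites of the block `z`. [folklore] -/
def bOfSites (t δ : ℝ) (z : ℤ × ℤ) : Set (Site 2) := {v | bOf t δ v = z}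

/-- The first coordinates of the sites of a block form the integer interval of `x` with
`⌊δ x / t⌋ = z.1`; characterisation of membership by the two floors. [folklore] -/
theorem mem_bOfSites_iff {z : ℤ × ℤ} {v : Site 2} : v ∈ bOfSites t δ z ↔ ⌊δ * v 0 / t⌋ = z.1 ∧ ⌊δ * v 1 / t⌋ = z.2 := by
  simp [bOfSites, bOf, Prod.ext_iff]

/-- **Floors of `δ x / t` are monotone and take consecutive values along the integers.** [folklore] -/
theorem floor_mono (ht : 0 < t) (hδ : 0 ≤ δ) {x y : ℤ} (h : x ≤ y) : ⌊δ * x / t⌋ ≤ ⌊δ * y / t⌋ :=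
  Int.floor_le_floor (div_le_div_of_nonneg_right (mul_le_mul_of_nonneg_left (by exact_mod_cast h) hδ) ht.le)

/-- Between two integers with floors `a` and `b ≥ a`, every intermediate floor value in `[a, b]` is
attained… in the form needed: the set of integers with a given floor value is an interval. [folklore] -/
theorem floor_between (ht : 0 < t) (hδ : 0 ≤ δ) {x y w : ℤ} (hxw : x ≤ w) (hwy : w ≤ y) {n : ℤ}
    (hx : ⌊δ * x / t⌋ = n) (hy : ⌊δ * y / t⌋ = n) : ⌊δ * w / t⌋ = n := by
  have h1 := floor_mono ht hδ hxw
  have h2 := floor_mono ht hδ hwy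
  omega

/-- Coordinates along a line of unit steps: direction `0`. [folklore] -/
theorem apply_add_smul_cornerUnit_zero (u : Site 2) (j : ℤ) :
    (u + j • cornerUnit 0) 0 = u 0 + j ∧ (u + j • cornerUnit 0) 1 = u 1 := by
  constructor <;> simp [cornerUnit, Pi.add_apply]

/-- Coordinates along a line of unit steps: direction `2`. [folklore] -/
theorem apply_add_smul_cornerUnit_two (u : Site 2) (j : ℤ) :
    (u + j • cornerUnit 2) 0 = u 0 - j ∧ (u + j • cornerUnit 2) 1 = u 1 := by
  constructor <;> simp [cornerUnit, Pi.add_apply, sub_eq_add_neg]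

/-- Coordinates along a line of unit steps: direction `1`. [folklore] -/
theorem apply_add_smul_cornerUnit_one (u : Site 2) (j : ℤ) :
    (u + j • cornerUnit 1) 0 = u 0 ∧ (u + j • cornerUnit 1) 1 = u 1 + j := by
  constructor <;> simp [cornerUnit, Pi.add_apply]

/-- Coordinates along a line of unit steps: direction `3`. [folklore] -/
theorem apply_add_smul_cornerUnit_three (u : Site 2) (j : ℤ) :
    (u + j • cornerUnit 3) 0 = u 0 ∧ (u + j • cornerUnit 3) 1 = u 1 - j := by
  constructor <;> simp [cornerUnit, Pi.add_apply, sub_eq_add_neg]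

/-- A site is determined by its two coordinates. [folklore] -/
private theorem site_ext {u v : Site 2} (h0 : u 0 = v 0) (h1 : u 1 = v 1) : u = v := by
  funext i; fin_cases i
  · exact h0
  · exact h1

/-- **Horizontal moves inside a block**: from `u` to the site with first coordinate `x` (same floor) and
the same second coordinate. [folklore] -/
theorem reflTransGen_horizontal (ht : 0 < t) (hδ : 0 ≤ δ) {z : ℤ × ℤ} {u v : Site 2} (hu : u ∈ bOfSites t δ z)
    (hv0 : ⌊δ * v 0 / t⌋ = z.1) (hv1 : v 1 = u 1) :
    ReflTransGen (fun a b : Site 2 => a ∈ bOfSites t δ z ∧ b ∈ bOfSites t δ z ∧ (zdGraph 2).Adj a b) u v := by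
  obtain ⟨hu0, hu1⟩ := mem_bOfSites_iff.1 hu
  rcases le_total (u 0) (v 0) with h | h
  · have key := CellComplex.reflTransGen_line (fun a => a ∈ bOfSites t δ z) u 0 (v 0 - u 0).toNat (fun j hj => by
      obtain ⟨e0, e1⟩ := apply_add_smul_cornerUnit_zero u j
      refine mem_bOfSites_iff.2 ⟨?_, by rw [e1]; exact hu1⟩
      rw [e0]
      exact floor_between ht hδ (by omega) (by omega : u 0 + j ≤ v 0) hu0 hv0)
    have e : u + ((v 0 - u 0).toNat : ℤ) • cornerUnit 0 = v := by
      obtain ⟨e0, e1⟩ := apply_add_smul_cornerUnit_zero u ((v 0 - u 0).toNat : ℤ)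
      exact site_ext (by rw [e0]; omega) (by rw [e1, hv1])
    exact e ▸ key
  · have key := CellComplex.reflTransGen_line (fun a => a ∈ bOfSites t δ z) u 2 (u 0 - v 0).toNat (fun j hj => by
      obtain ⟨e0, e1⟩ := apply_add_smul_cornerUnit_two u j
      refine mem_bOfSites_iff.2 ⟨?_, by rw [e1]; exact hu1⟩
      rw [e0]
      exact floor_between ht hδ (by omega : v 0 ≤ u 0 - j) (by omega) hv0 hu0)
    have e : u + ((u 0 - v 0).toNat : ℤ) • cornerUnit 2 = v := by
      obtain ⟨e0, e1⟩ := apply_add_smul_cornerUnit_two u ((u 0 - v 0).toNat : ℤ)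
      exact site_ext (by rw [e0]; omega) (by rw [e1, hv1])
    exact e ▸ key

/-- **Vertical moves inside a block.** [folklore] -/
theorem reflTransGen_vertical (ht : 0 < t) (hδ : 0 ≤ δ) {z : ℤ × ℤ} {u v : Site 2} (hu : u ∈ bOfSites t δ z)
    (hv0 : v 0 = u 0) (hv1 : ⌊δ * v 1 / t⌋ = z.2) :
    ReflTransGen (fun a b : Site 2 => a ∈ bOfSites t δ z ∧ b ∈ bOfSites t δ z ∧ (zdGraph 2).Adj a b) u v := by
  obtain ⟨hu0, hu1⟩ := mem_bOfSites_iff.1 hu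
  rcases le_total (u 1) (v 1) with h | h
  · have key := CellComplex.reflTransGen_line (fun a => a ∈ bOfSites t δ z) u 1 (v 1 - u 1).toNat (fun j hj => by
      obtain ⟨e0, e1⟩ := apply_add_smul_cornerUnit_one u j
      refine mem_bOfSites_iff.2 ⟨by rw [e0]; exact hu0, ?_⟩
      rw [e1]
      exact floor_between ht hδ (by omega) (by omega : u 1 + j ≤ v 1) hu1 hv1)
    have e : u + ((v 1 - u 1).toNat : ℤ) • cornerUnit 1 = v := by
      obtain ⟨e0, e1⟩ := apply_add_smul_cornerUnit_one u ((v 1 - u 1).toNat : ℤ)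
      exact site_ext (by rw [e0, hv0]) (by rw [e1]; omega)
    exact e ▸ key
  · have key := CellComplex.reflTransGen_line (fun a => a ∈ bOfSites t δ z) u 3 (u 1 - v 1).toNat (fun j hj => by
      obtain ⟨e0, e1⟩ := apply_add_smul_cornerUnit_three u j
      refine mem_bOfSites_iff.2 ⟨by rw [e0]; exact hu0, ?_⟩
      rw [e1]
      exact floor_between ht hδ (by omega : v 1 ≤ u 1 - j) (by omega) hv1 hu1)
    have e : u + ((u 1 - v 1).toNat : ℤ) • cornerUnit 3 = v := by
      obtain ⟨e0, e1⟩ := apply_add_smul_cornerUnit_three u ((u 1 - v 1).toNat : ℤ)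
      exact site_ext (by rw [e0, hv0]) (by rw [e1]; omega)
    exact e ▸ key

/-- **The sites of a block are joined through sites of the block.** [folklore] -/
theorem bOfSites_connected (ht : 0 < t) (hδ : 0 ≤ δ) {z : ℤ × ℤ} {u v : Site 2} (hu : u ∈ bOfSites t δ z)
    (hv : v ∈ bOfSites t δ z) :
    ReflTransGen (fun a b : Site 2 => a ∈ bOfSites t δ z ∧ b ∈ bOfSites t δ z ∧ (zdGraph 2).Adj a b) u v := by
  obtain ⟨hv0, hv1⟩ := mem_bOfSites_iff.1 hv
  obtain ⟨hu0, hu1⟩ := mem_bOfSites_iff.1 hu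
  -- through the corner `w = (v 0, u 1)`
  set w : Site 2 := ![v 0, u 1] with hw
  have hw0 : w 0 = v 0 := rfl
  have hw1 : w 1 = u 1 := rfl
  have hwz : w ∈ bOfSites t δ z := mem_bOfSites_iff.2 ⟨by rw [hw0]; exact hv0, by rw [hw1]; exact hu1⟩
  exact (reflTransGen_horizontal ht hδ hu (by rw [hw0]; exact hv0) hw1).trans
    (reflTransGen_vertical ht hδ hwz hw0.symm hv1)

/-! ### Adjacent blocks contain adjacent sites -/

/-- **The integers with floor value `n` form a nonempty set** when `δ ≤ t`: explicitly
`x = ⌈t n / δ⌉` has `⌊δ x / t⌋ = n`. [folklore] -/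
theorem floor_ceil_eq (ht : 0 < t) (hδ : 0 < δ) (hδt : δ ≤ t) (n : ℤ) : ⌊δ * (⌈t * n / δ⌉ : ℤ) / t⌋ = n := by
  rw [Int.floor_eq_iff]
  have h1 : t * n / δ ≤ (⌈t * n / δ⌉ : ℝ) := Int.le_ceil _
  have h2 : (⌈t * n / δ⌉ : ℝ) < t * n / δ + 1 := Int.ceil_lt_add_one _
  constructor
  · rw [le_div_iff₀ ht]
    rw [div_le_iff₀ hδ] at h1
    nlinarith
  · rw [div_lt_iff₀ ht]
    have : δ * (⌈t * n / δ⌉ : ℝ) < δ * (t * n / δ + 1) := mul_lt_mul_of_pos_left h2 hδ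
    rw [mul_add, mul_div_cancel₀ _ hδ.ne', mul_one] at this
    nlinarith

/-- **The last integer with floor value `n`**: `x = ⌈t (n+1) / δ⌉ - 1` has floor `n` and `x + 1` has
floor `n + 1`. [folklore] -/
theorem floor_last (ht : 0 < t) (hδ : 0 < δ) (hδt : δ ≤ t) (n : ℤ) :
    ⌊δ * ((⌈t * (n + 1) / δ⌉ - 1 : ℤ) : ℝ) / t⌋ = n ∧ ⌊δ * (⌈t * (n + 1) / δ⌉ : ℤ) / t⌋ = n + 1 := by
  have hnext : ⌊δ * (⌈t * (n + 1) / δ⌉ : ℤ) / t⌋ = n + 1 := by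
    have := floor_ceil_eq ht hδ hδt (n + 1)
    push_cast at this ⊢
    exact this
  refine ⟨?_, hnext⟩
  rw [Int.floor_eq_iff]
  set c : ℤ := ⌈t * (n + 1) / δ⌉ with hc
  have h1 : t * (n + 1) / δ ≤ (c : ℝ) := Int.le_ceil _
  have h2 : (c : ℝ) < t * (n + 1) / δ + 1 := Int.ceil_lt_add_one _
  -- `c - 1 < t(n+1)/δ`, so `δ (c-1) < t (n+1)`; and `δ (c - 1) ≥ t(n+1) - δ ≥ t n`
  rw [div_le_iff₀ hδ] at h1
  rw [le_div_iff₀ ht, div_lt_iff₀ ht]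
  push_cast
  constructor
  · nlinarith
  · have : ((c : ℝ) - 1) < t * (n + 1) / δ := by linarith
    rw [lt_div_iff₀ hδ] at this
    nlinarith

/-- **4-adjacent blocks contain adjacent sites.** [folklore] -/
theorem exists_adj_sites_of_oneStep (ht : 0 < t) (hδ : 0 < δ) (hδt : δ ≤ t) {a b : ℤ × ℤ} (hab : OneStep a b) :
    ∃ u v : Site 2, (zdGraph 2).Adj u v ∧ u ∈ bOfSites t δ a ∧ v ∈ bOfSites t δ b := by
  -- reduce to the two increasing cases by symmetry
  have main : ∀ a b : ℤ × ℤ, (a.1 = b.1 ∧ b.2 = a.2 + 1) ∨ (a.2 = b.2 ∧ b.1 = a.1 + 1) →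
      ∃ u v : Site 2, (zdGraph 2).Adj u v ∧ u ∈ bOfSites t δ a ∧ v ∈ bOfSites t δ b := by
    rintro a b (⟨h1, h2⟩ | ⟨h1, h2⟩)
    · -- vertical step: `u = (x₀, y)`, `v = (x₀, y+1)` with `y` the last row of floor `a.2`
      obtain ⟨hy, hy'⟩ := floor_last ht hδ hδt a.2
      set x₀ : ℤ := ⌈t * a.1 / δ⌉
      set y : ℤ := ⌈t * (a.2 + 1) / δ⌉ - 1
      refine ⟨![x₀, y], ![x₀, y + 1], ?_, ?_, ?_⟩
      · rw [adj_iff_exists_cornerUnit]; refine ⟨1, ?_⟩; funext i; fin_cases i <;> simp [cornerUnit]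
      · exact mem_bOfSites_iff.2 ⟨by simpa using floor_ceil_eq ht hδ hδt a.1, by simpa using hy⟩
      · refine mem_bOfSites_iff.2 ⟨by rw [← h1]; simpa using floor_ceil_eq ht hδ hδt a.1, ?_⟩
        rw [h2]; simp only [Matrix.cons_val_one, Matrix.cons_val_zero]
        have : ((y + 1 : ℤ) : ℝ) = ((⌈t * (a.2 + 1) / δ⌉ : ℤ) : ℝ) := by simp [y]
        rw [this]; exact hy'
    · obtain ⟨hx, hx'⟩ := floor_last ht hδ hδt a.1
      set y₀ : ℤ := ⌈t * a.2 / δ⌉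
      set x : ℤ := ⌈t * (a.1 + 1) / δ⌉ - 1
      refine ⟨![x, y₀], ![x + 1, y₀], ?_, ?_, ?_⟩
      · rw [adj_iff_exists_cornerUnit]; refine ⟨0, ?_⟩; funext i; fin_cases i <;> simp [cornerUnit]
      · exact mem_bOfSites_iff.2 ⟨by simpa using hx, by simpa using floor_ceil_eq ht hδ hδt a.2⟩
      · refine mem_bOfSites_iff.2 ⟨?_, by rw [← h1]; simpa using floor_ceil_eq ht hδ hδt a.2⟩
        rw [h2]; simp only [Matrix.cons_val_zero]
        have : ((x + 1 : ℤ) : ℝ) = ((⌈t * (a.1 + 1) / δ⌉ : ℤ) : ℝ) := by simp [x]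
        rw [this]; exact hx'
  rcases hab with ⟨h1, h2⟩ | ⟨h1, h2⟩
  · rcases (by have := h2; rw [abs_eq (by norm_num : (0:ℤ) ≤ 1)] at this; omega : b.2 = a.2 + 1 ∨ a.2 = b.2 + 1) with h | h
    · exact main a b (Or.inl ⟨h1, h⟩)
    · obtain ⟨u, v, huv, hu, hv⟩ := main b a (Or.inl ⟨h1.symm, h⟩)
      exact ⟨v, u, huv.symm, hv, hu⟩
  · rcases (by have := h2; rw [abs_eq (by norm_num : (0:ℤ) ≤ 1)] at this; omega : b.1 = a.1 + 1 ∨ a.1 = b.1 + 1) with h | h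
    · exact main a b (Or.inr ⟨h1, h⟩)
    · obtain ⟨u, v, huv, hu, hv⟩ := main b a (Or.inr ⟨h1.symm, h⟩)
      exact ⟨v, u, huv.symm, hv, hu⟩

/-- Every block contains a site. [folklore] -/
theorem bOfSites_nonempty (ht : 0 < t) (hδ : 0 < δ) (hδt : δ ≤ t) (z : ℤ × ℤ) : (bOfSites t δ z).Nonempty :=
  ⟨![⌈t * z.1 / δ⌉, ⌈t * z.2 / δ⌉], mem_bOfSites_iff.2
    ⟨by simpa using floor_ceil_eq ht hδ hδt z.1, by simpa using floor_ceil_eq ht hδ hδt z.2⟩⟩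

/-! ### Finiteness -/

/-- The sites of one block form a finite set. [folklore] -/
theorem bOfSites_finite (ht : 0 < t) (hδ : 0 < δ) (z : ℤ × ℤ) : (bOfSites t δ z).Finite := by
  -- the coordinates are confined to bounded integer intervals
  have bound : ∀ (x : ℤ) (n : ℤ), ⌊δ * x / t⌋ = n → t * n / δ - 1 ≤ x ∧ (x : ℝ) ≤ t * (n + 1) / δ := by
    intro x n h
    rw [Int.floor_eq_iff] at h
    obtain ⟨h1, h2⟩ := h
    rw [le_div_iff₀ ht] at h1
    rw [div_lt_iff₀ ht] at h2
    constructor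
    · rw [div_sub' (ne_of_gt hδ), div_le_iff₀ hδ]; nlinarith
    · rw [le_div_iff₀ hδ]; nlinarith
  set I0 := Finset.Icc (⌊t * z.1 / δ - 1⌋) (⌈t * (z.1 + 1) / δ⌉) with hI0
  set I1 := Finset.Icc (⌊t * z.2 / δ - 1⌋) (⌈t * (z.2 + 1) / δ⌉) with hI1
  refine ((I0 ×ˢ I1).finite_toSet.image fun p : ℤ × ℤ => (![p.1, p.2] : Site 2)).subset ?_
  intro v hv
  obtain ⟨h0, h1⟩ := mem_bOfSites_iff.1 hv
  obtain ⟨a0, b0⟩ := bound (v 0) z.1 h0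
  obtain ⟨a1, b1⟩ := bound (v 1) z.2 h1
  refine ⟨(v 0, v 1), ?_, by funext i; fin_cases i <;> rfl⟩
  simp only [Finset.coe_product, Set.mem_prod, Finset.coe_Icc, Set.mem_Icc, hI0, hI1]
  refine ⟨⟨Int.floor_le_iff.2 (by linarith), Int.le_ceil_iff.2 (by linarith)⟩,
    ⟨Int.floor_le_iff.2 (by linarith), Int.le_ceil_iff.2 (by linarith)⟩⟩

/-- **Finitely many sites have their block in a finite set.** [folklore] -/
theorem finite_sites_of_bOf (ht : 0 < t) (hδ : 0 < δ) {B : Set (ℤ × ℤ)} (hB : B.Finite) :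
    {v : Site 2 | bOf t δ v ∈ B}.Finite := by
  have : {v : Site 2 | bOf t δ v ∈ B} = ⋃ z ∈ B, bOfSites t δ z := by
    ext v; simp [bOfSites]
  rw [this]
  exact hB.biUnion fun z _ => bOfSites_finite ht hδ z

end FineBlocks

end Literature.Probability.Percolation

end
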